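import Summits.Ventures.PercRepro.ProfileMixedStep

/-!
# PercRepro — THE COGIRTH LEMMA: a matroid of rank `r` and cogirth `≥ g` has `≥ C(r+g−1, j)` independent `j`-sets
(p10, gen 2; S5, Theorem A of `proofs/SUBCLAIM-S5-p10.md` §2.6)

`CogirthGe M g` is the rank form of «every cocircuit of `M` has at least `g` elements»: every `X ⊆ E` with
`ρ(X) + 1 = ρ(E)` misses at least `g` elements of `E` (a cocircuit is the complement of a hyperplane, and every
`X` of rank `ρ(E) − 1` lies in the hyperplane `cl X`).  The lemma is the single-element deletion–contraction
induction `I_j(M) = I_j(M ∖ e) + I_{j−1}(M / e)` for a non-loop `e` (which is not a coloop when `g ≥ 2`):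
`M ∖ e` keeps the rank and has cogirth `≥ g − 1`, `M / e` has rank `r − 1` and cogirth `≥ g`, and Pascal's rule
closes the count.  Base: `g = 1` — the `j`-subsets of a basis.  Tight on `U_{r, r+g−1}`; `g = 2` is the
cell's Claim Q (coloop-free matroids, MINE2-RLS.md §13).  Verified exactly on every matroid on ≤ 9 elements
(0 failures / 2,107,446 tests, 383,337 tight; `mining/p10/g2/cogirth_test.c`).

* `indepSets M j` — the independent `j`-subsets of the ground finset;
* `CogirthGe M g` — cogirth `≥ g` in rank form;
* `cogirthGe_delete`, `cogirthGe_contract` — the two minors;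
* `card_indepSets_ge_of_delete_contract` — `I_j(M) ≥ I_j(M ∖ e) + I_{j−1}(M / e)`;
* **`choose_le_card_indepSets`** — the lemma: `CogirthGe M g → 1 ≤ g → j ≤ ρ(E) → C(ρ(E)+g−1, j) ≤ #indepSets M j`.
-/

open scoped Matroid

namespace PercRepro.Cogirth

open Finset ThmH Skew

variable {α : Type} [DecidableEq α] {M : Matroid α} [M.Finite]

open Classical in
/-- The independent `j`-subsets of the ground finset. -/
noncomputable def indepSets (M : Matroid α) [M.Finite] (j : ℕ) : Finset (Finset α) :=
  (gr M).powerset.filter (fun I => I.card = j ∧ M.Indep (I : Set α))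

omit [DecidableEq α] in
open Classical in
/-- Membership in `indepSets`. -/
theorem mem_indepSets {j : ℕ} {I : Finset α} :
    I ∈ indepSets M j ↔ I ⊆ gr M ∧ I.card = j ∧ M.Indep (I : Set α) := by
  unfold indepSets
  rw [mem_filter, mem_powerset]

/-- **Cogirth at least `g`**, in rank form: every subset `X` of the ground set with `ρ(X) + 1 = ρ(E)`
misses at least `g` elements of `E`. -/
def CogirthGe (M : Matroid α) [M.Finite] (g : ℕ) : Prop :=
  ∀ X ⊆ gr M, rk M X + 1 = rk M (gr M) → g ≤ (gr M \ X).card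

/-! ### Rank facts (natural-number rank `rk`) -/

omit [DecidableEq α] in
/-- `rk` is monotone. -/
theorem rk_mono' {X Y : Finset α} (hXY : X ⊆ Y) : rk M X ≤ rk M Y := by
  have h : M.eRk (X : Set α) ≤ M.eRk (Y : Set α) := M.eRk_mono (by exact_mod_cast hXY)
  rw [← coe_rk, ← coe_rk] at h
  exact_mod_cast h

/-- `rk (insert e X) ≤ rk X + 1`. -/
theorem rk_insert_le (e : α) (X : Finset α) : rk M (insert e X) ≤ rk M X + 1 := by
  have h := M.eRk_insert_le_add_one e (X : Set α)
  rw [← Finset.coe_insert, ← coe_rk, ← coe_rk] at h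
  exact_mod_cast h

omit [DecidableEq α] in
/-- `rk X ≤ #X`. -/
theorem rk_le_card (X : Finset α) : rk M X ≤ X.card := by
  have h := M.eRk_le_encard (X : Set α)
  rw [Set.encard_coe_eq_coe_finsetCard, ← coe_rk] at h
  exact_mod_cast h

omit [DecidableEq α] in
/-- A basis, as a finset of size `rk M (gr M)`. -/
theorem exists_basis_finset :
    ∃ B : Finset α, B ⊆ gr M ∧ B.card = rk M (gr M) ∧ M.Indep (B : Set α) := by
  obtain ⟨B, hB⟩ := M.exists_isBase
  have hBfin : B.Finite := M.ground_finite.subset hB.subset_ground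
  refine ⟨hBfin.toFinset, ?_, ?_, ?_⟩
  · intro x hx
    rw [Set.Finite.mem_toFinset] at hx
    have : x ∈ M.E := hB.subset_ground hx
    rw [← coe_gr] at this
    exact_mod_cast this
  · have h1 := hB.encard_eq_eRank
    have h2 : B = (hBfin.toFinset : Set α) := (Set.Finite.coe_toFinset hBfin).symm
    rw [h2, Set.encard_coe_eq_coe_finsetCard, ← M.eRk_ground, ← coe_gr, ← coe_rk] at h1
    exact_mod_cast h1
  · rw [Set.Finite.coe_toFinset]
    exact hB.indep

omit [DecidableEq α] in
/-- Base case `g = 1`: the `j`-subsets of a basis are `C(ρ(E), j)` independent `j`-sets. -/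
theorem choose_rk_le_card_indepSets (j : ℕ) : (rk M (gr M)).choose j ≤ (indepSets M j).card := by
  obtain ⟨B, hBg, hBc, hBi⟩ := exists_basis_finset (M := M)
  have hsub : B.powersetCard j ⊆ indepSets M j := by
    intro I hI
    rw [mem_powersetCard] at hI
    rw [mem_indepSets]
    refine ⟨hI.1.trans hBg, hI.2, hBi.subset ?_⟩
    exact_mod_cast hI.1
  have := card_le_card hsub
  rwa [card_powersetCard, hBc] at this

omit [DecidableEq α] in
/-- The empty set is an independent `0`-set. -/
theorem one_le_card_indepSets_zero : 1 ≤ (indepSets M 0).card := by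
  apply card_pos.2
  refine ⟨∅, ?_⟩
  rw [mem_indepSets]
  exact ⟨empty_subset _, card_empty, by simp⟩

/-! ### The two minors -/

section Minors

variable {e : α} {g : ℕ}

/-- A non-coloop `e`: deleting it keeps the rank (from cogirth `≥ 2`). -/
theorem rk_erase_eq_of_cogirthGe (hg : CogirthGe M g) (hg2 : 2 ≤ g) (he : e ∈ gr M) :
    rk M ((gr M).erase e) = rk M (gr M) := by
  have hle : rk M ((gr M).erase e) ≤ rk M (gr M) := rk_mono' (erase_subset e _)
  have hge : rk M (gr M) ≤ rk M ((gr M).erase e) + 1 := by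
    have := rk_insert_le (M := M) e ((gr M).erase e)
    rwa [insert_erase he] at this
  by_contra hne
  have h1 : rk M ((gr M).erase e) + 1 = rk M (gr M) := by omega
  have h2 := hg ((gr M).erase e) (erase_subset e _) h1
  have h3 : gr M \ (gr M).erase e = {e} := by
    ext x
    simp only [mem_sdiff, mem_erase, mem_singleton]
    constructor
    · rintro ⟨hx, hx'⟩
      by_contra hxe
      exact hx' ⟨hxe, hx⟩
    · rintro rfl
      exact ⟨he, fun h => h.1 rfl⟩
  rw [h3, card_singleton] at h2
  omega

/-- Deletion: the rank of the ground set of `M ∖ e` is that of `M` (for a non-coloop `e`). -/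
theorem rk_gr_delete (hg : CogirthGe M g) (hg2 : 2 ≤ g) (he : e ∈ gr M) :
    rk (M ＼ ({e} : Set α)) (gr (M ＼ ({e} : Set α))) = rk M (gr M) := by
  rw [gr_delete', rk_delete (subset_refl _), rk_erase_eq_of_cogirthGe hg hg2 he]

/-- Contraction of a non-loop: the rank of the ground set drops by one. -/
theorem rk_gr_contract_add_one (he : M.Indep {e}) (heE : e ∈ gr M) :
    rk (M ／ ({e} : Set α)) (gr (M ／ ({e} : Set α))) + 1 = rk M (gr M) := by
  rw [gr_contract', rk_contract_add_one he (subset_refl _), insert_erase heE]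

/-- `gr M \ X = insert e ((gr M).erase e \ X)` for `X` avoiding `e`. -/
theorem sdiff_eq_insert_erase_sdiff (he : e ∈ gr M) {X : Finset α} (hX : X ⊆ (gr M).erase e) :
    gr M \ X = insert e ((gr M).erase e \ X) := by
  have heX : e ∉ X := fun h => (mem_erase.1 (hX h)).1 rfl
  ext x
  simp only [mem_sdiff, mem_insert, mem_erase]
  constructor
  · rintro ⟨hx, hxX⟩
    by_cases hxe : x = e
    · exact Or.inl hxe
    · exact Or.inr ⟨⟨hxe, hx⟩, hxX⟩
  · rintro (rfl | ⟨⟨_, hx⟩, hxX⟩)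
    · exact ⟨he, heX⟩
    · exact ⟨hx, hxX⟩

/-- `gr M \ insert e X = (gr M).erase e \ X`. -/
theorem sdiff_insert_eq_erase_sdiff (e : α) (X : Finset α) :
    gr M \ insert e X = (gr M).erase e \ X := by
  ext x
  simp only [mem_sdiff, mem_insert, mem_erase, not_or]
  tauto

/-- Deleting a non-coloop lowers the cogirth bound by at most one. -/
theorem cogirthGe_delete (hg : CogirthGe M g) (hg2 : 2 ≤ g) (he : e ∈ gr M) :
    CogirthGe (M ＼ ({e} : Set α)) (g - 1) := by
  intro X hX hrk
  rw [gr_delete'] at hX hrk ⊢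
  rw [rk_delete hX, rk_delete (subset_refl _), rk_erase_eq_of_cogirthGe hg hg2 he] at hrk
  have h := hg X (hX.trans (erase_subset e _)) hrk
  rw [sdiff_eq_insert_erase_sdiff he hX, card_insert_of_notMem] at h
  · omega
  · intro hmem
    exact (mem_erase.1 (mem_sdiff.1 hmem).1).1 rfl

/-- Contracting a non-loop keeps the cogirth bound. -/
theorem cogirthGe_contract (hg : CogirthGe M g) (he : M.Indep {e}) (heE : e ∈ gr M) :
    CogirthGe (M ／ ({e} : Set α)) g := by
  intro X hX hrk
  rw [gr_contract'] at hX hrk ⊢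
  have h1 := rk_contract_add_one he hX
  have h2 := rk_gr_contract_add_one he heE
  rw [gr_contract'] at h2
  have h3 : rk M (insert e X) + 1 = rk M (gr M) := by omega
  have h := hg (insert e X) (insert_subset heE (hX.trans (erase_subset e _))) h3
  rwa [sdiff_insert_eq_erase_sdiff] at h

/-- `I_{j+1}(M) ≥ I_{j+1}(M ∖ e) + I_j(M / e)` for a non-loop `e`: the independent `(j+1)`-sets of
`M ∖ e` avoid `e`, those of `M / e` give independent `(j+1)`-sets of `M` through `e` by inserting it. -/
theorem card_indepSets_ge_of_delete_contract (he : M.Indep {e}) (heE : e ∈ gr M) (j : ℕ) :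
    (indepSets (M ＼ ({e} : Set α)) (j + 1)).card + (indepSets (M ／ ({e} : Set α)) j).card ≤
      (indepSets M (j + 1)).card := by
  have hAsub : indepSets (M ＼ ({e} : Set α)) (j + 1) ⊆ indepSets M (j + 1) := by
    intro I hI
    rw [mem_indepSets, gr_delete'] at hI
    rw [mem_indepSets]
    refine ⟨hI.1.trans (erase_subset e _), hI.2.1, ?_⟩
    exact (Matroid.delete_indep_iff.1 hI.2.2).1
  have hCsub : (indepSets (M ／ ({e} : Set α)) j).image (insert e) ⊆ indepSets M (j + 1) := by
    intro I hI
    rw [mem_image] at hI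
    obtain ⟨I', hI', rfl⟩ := hI
    rw [mem_indepSets, gr_contract'] at hI'
    have heI' : e ∉ I' := fun h => (mem_erase.1 (hI'.1 h)).1 rfl
    rw [mem_indepSets]
    refine ⟨insert_subset heE (hI'.1.trans (erase_subset e _)), ?_, ?_⟩
    · rw [card_insert_of_notMem heI', hI'.2.1]
    · have h := (he.contract_indep_iff.1 hI'.2.2).2
      rw [Set.union_singleton] at h
      rw [Finset.coe_insert]
      exact h
  have hdisj : Disjoint (indepSets (M ＼ ({e} : Set α)) (j + 1))
      ((indepSets (M ／ ({e} : Set α)) j).image (insert e)) := by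
    rw [disjoint_left]
    intro I hIA hIC
    rw [mem_indepSets, gr_delete'] at hIA
    rw [mem_image] at hIC
    obtain ⟨I', _, rfl⟩ := hIC
    exact (mem_erase.1 (hIA.1 (mem_insert_self e I'))).1 rfl
  have hCcard : ((indepSets (M ／ ({e} : Set α)) j).image (insert e)).card =
      (indepSets (M ／ ({e} : Set α)) j).card := by
    apply card_image_of_injOn
    intro I hI I' hI' hII'
    have heI : e ∉ I := by
      rw [Finset.mem_coe, mem_indepSets, gr_contract'] at hI
      exact fun h => (mem_erase.1 (hI.1 h)).1 rfl
    have heI' : e ∉ I' := by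
      rw [Finset.mem_coe, mem_indepSets, gr_contract'] at hI'
      exact fun h => (mem_erase.1 (hI'.1 h)).1 rfl
    have h := congrArg (fun S : Finset α => S.erase e) hII'
    simp only [erase_insert heI, erase_insert heI'] at h
    exact h
  calc (indepSets (M ＼ ({e} : Set α)) (j + 1)).card + (indepSets (M ／ ({e} : Set α)) j).card
      = (indepSets (M ＼ ({e} : Set α)) (j + 1)).card +
          ((indepSets (M ／ ({e} : Set α)) j).image (insert e)).card := by rw [hCcard]
    _ = (indepSets (M ＼ ({e} : Set α)) (j + 1) ∪
          (indepSets (M ／ ({e} : Set α)) j).image (insert e)).card :=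
        (card_union_of_disjoint hdisj).symm
    _ ≤ (indepSets M (j + 1)).card := card_le_card (union_subset hAsub hCsub)

end Minors

/-! ### The lemma -/

/-- **The cogirth lemma** (induction form): for every `n`, every finite matroid on `n` elements, every
`g ≥ 1` with cogirth `≥ g` and every `j ≤ ρ(E)`, `C(ρ(E) + g − 1, j) ≤ #indepSets M j`. -/
theorem choose_le_card_indepSets_aux (n : ℕ) : ∀ (M : Matroid α) [M.Finite], (gr M).card = n →
    ∀ g : ℕ, 1 ≤ g → CogirthGe M g → ∀ j : ℕ, j ≤ rk M (gr M) →
      (rk M (gr M) + g - 1).choose j ≤ (indepSets M j).card := by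
  induction n using Nat.strong_induction_on with
  | _ n ih =>
  intro M _ hn g hg1 hg j hj
  rcases Nat.lt_or_ge g 2 with hg2 | hg2
  · -- `g = 1`: the subsets of a basis
    have hg1' : g = 1 := by omega
    subst hg1'
    simpa using choose_rk_le_card_indepSets (M := M) j
  rcases Nat.eq_zero_or_pos (rk M (gr M)) with hr0 | hr0
  · -- rank `0`: only `j = 0`
    have hj0 : j = 0 := by omega
    subst hj0
    rw [Nat.choose_zero_right]
    exact one_le_card_indepSets_zero
  -- rank `≥ 1`, `g ≥ 2`: a non-loop `e`, which is not a coloop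
  obtain ⟨B, hBg, hBc, hBi⟩ := exists_basis_finset (M := M)
  have hBne : B.Nonempty := by
    rw [← card_pos, hBc]
    exact hr0
  obtain ⟨e, heB⟩ := hBne
  have heE : e ∈ gr M := hBg heB
  have he : M.Indep {e} := hBi.subset (Set.singleton_subset_iff.2 (Finset.mem_coe.2 heB))
  have hcard : ((gr M).erase e).card = n - 1 := by
    rw [card_erase_of_mem heE, hn]
  have hlt : n - 1 < n := by
    have : 0 < n := by
      rw [← hn]
      exact card_pos.2 ⟨e, heE⟩
    omega
  -- the deletion minor
  have hD := ih (n - 1) hlt (M ＼ ({e} : Set α)) (by rw [gr_delete', hcard]) (g - 1) (by omega)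
    (cogirthGe_delete hg hg2 heE)
  have hrD : rk (M ＼ ({e} : Set α)) (gr (M ＼ ({e} : Set α))) = rk M (gr M) :=
    rk_gr_delete hg hg2 heE
  -- the contraction minor
  have hC := ih (n - 1) hlt (M ／ ({e} : Set α)) (by rw [gr_contract', hcard]) g hg1
    (cogirthGe_contract hg he heE)
  have hrC : rk (M ／ ({e} : Set α)) (gr (M ／ ({e} : Set α))) + 1 = rk M (gr M) :=
    rk_gr_contract_add_one he heE
  -- the count
  rcases j with _ | j
  · rw [Nat.choose_zero_right]
    exact one_le_card_indepSets_zero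
  have h1 := hD (j + 1) (by omega)
  have h2 := hC j (by omega)
  have e1 : rk (M ＼ ({e} : Set α)) (gr (M ＼ ({e} : Set α))) + (g - 1) - 1 = rk M (gr M) + g - 2 := by
    omega
  have e2 : rk (M ／ ({e} : Set α)) (gr (M ／ ({e} : Set α))) + g - 1 = rk M (gr M) + g - 2 := by
    omega
  have e3 : rk M (gr M) + g - 1 = (rk M (gr M) + g - 2) + 1 := by omega
  rw [e1] at h1
  rw [e2] at h2
  rw [e3, Nat.choose_succ_succ]
  calc (rk M (gr M) + g - 2).choose j + (rk M (gr M) + g - 2).choose (j + 1)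
      ≤ (indepSets (M ／ ({e} : Set α)) j).card + (indepSets (M ＼ ({e} : Set α)) (j + 1)).card :=
        Nat.add_le_add h2 h1
    _ = (indepSets (M ＼ ({e} : Set α)) (j + 1)).card + (indepSets (M ／ ({e} : Set α)) j).card := by
        rw [Nat.add_comm]
    _ ≤ (indepSets M (j + 1)).card := card_indepSets_ge_of_delete_contract he heE j

/-- **THE COGIRTH LEMMA.** A finite matroid of rank `r = ρ(E)` in which every cocircuit has at least `g ≥ 1`
elements (rank form `CogirthGe M g`) has at least `C(r + g − 1, j)` independent `j`-sets, `0 ≤ j ≤ r`.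
Tight on `U_{r, r+g−1}`; `g = 2` is Claim Q (coloop-free matroids). -/
theorem choose_le_card_indepSets {g : ℕ} (hg1 : 1 ≤ g) (hg : CogirthGe M g) {j : ℕ}
    (hj : j ≤ rk M (gr M)) : (rk M (gr M) + g - 1).choose j ≤ (indepSets M j).card :=
  choose_le_card_indepSets_aux (gr M).card M rfl g hg1 hg j hj

end PercRepro.Cogirth
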